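import Summits.HodgeConjecture.HodgeConjecture.Theorems.F0P3cStCharTSCharacterEllipticUniform  -- ★ 41g-H (LH6-p04): tree letters at the datum + `char_eq_fixedVertexSum_sub_fixedEdgeSum`; brings (G3)-EXPLICIT letters, `Gqs`, `EllipticData`
import Summits.HodgeConjecture.HodgeConjecture.Theorems.F0P3cStCharTSEPGlueG                    -- ★ (G3) (LH10-p02): the letters-from-`hunr` pattern (`unramifiedLocalConjDatum_adicCompletion`, `localNonsplitEquiv`, `qsForm` re-reading)
import Summits.HodgeConjecture.HodgeConjecture.Theorems.F0P3cStCharTSEllMassG                   -- ★ (G4) (F0P3b-p01): the clause-2 PIN READER `orbInt_eq_zero_of_mem_regG_of_not_mem_ellG`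
import Summits.HodgeConjecture.HodgeConjecture.Theorems.F0P3cStCharTSEllipticFixedTree           -- ★ row 53 p853423 (F0P3a-p09): (H5) `ellipticFixedTree_of_mem_ellG` (the tree binders `hne hfin hfinE` on `G^e`)
import Summits.HodgeConjecture.HodgeConjecture.Theorems.F0P3cStCharTSEPFunctionOrbitalElliptic    -- ★ 48-datum FILE 2 p853465 (F0P3a-p01): `classOrbitalIntegral_epSum_eq_fixedVertexSum_sub_fixedEdgeSum` ((SS-O) at the datum)
import Summits.HodgeConjecture.HodgeConjecture.Theorems.F0P3cStCharTSEPNonEllipticVanishing       -- ★ 47e-E3 p853460 (LH6-p04): `classOrbitalIntegral_eq_zero_of_forall_smoothTrace_eq_zero` (van Dijk door, carries (o9))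
import Summits.HodgeConjecture.HodgeConjecture.Theorems.F0P3cStCharTSEPInducedTraceZeroAtDatumDischarge  -- ★ row 61b (F0P3a-p04 g32 ∕ F0P2-p06): `smoothTrace_cmPrincipalSeries_epFunction_eq_zero` — all principal-series traces of `f_EP^{π,e}` vanish (the former `h61`)
import Summits.HodgeConjecture.HodgeConjecture.Theorems.F0P3cStCharTSJacquetLine                  -- ★ JDIM2: `finrank_coinvariants_le_two` (the Jacquet module of an irreducible is finite-dimensional — ★ 61b's `hVN` at `r.ρ`)
import Literature.NumberTheory.Automorphic.SmoothCharacterEPFunctionTrace                         -- ★ row 42 (F0P2-p01): `Representation.mem_schwartzBruhat_of_kType` (clause 1)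
import Literature.NumberTheory.Automorphic.SmoothCharacterFiniteOrder                             -- ★ row 51: `Representation.levelTrace_inv_eq_conj_of_mem_of_isCompact` ((c) UNIT∕DUAL, termwise)
import Literature.NumberTheory.Automorphic.UnitaryLatticeTreeLevelGroupsTopology                  -- ★ row 43 (LH5-p04): level groups are a neighbourhood basis (the level `e`)
import Literature.NumberTheory.Automorphic.UnitaryLatticeTreeGeodesicApartment                    -- ★ 39γ: `exists_apartmentEnum`, `latticeGraph_adj_apartmentEnum_succ` (a base edge)
import Literature.NumberTheory.Automorphic.UnitaryGroupBorelInduction                             -- ★ `cmPrincipalSeries` (the `hsp` currency of 47e-E3 ∕ 47d-6b)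
import HarnessLib

/-!
# F0 · P3c · «StCharTS» — E1 row 58 «K1-UNR ASSEMBLY HEAD», FILE 1∕2 «WITNESS» (HOME-ONLY, NOT FILED): «the Euler–Poincaré function `f_EP^{π,e}` IS a pseudo-coefficient
# of `π`» at an unramified place, explicit letters, complete, every supplier ★ (the last one, 61b = the `hsp` at the datum, discharged inside)

Cell `pub/hodgecm-mathlib` (D-0151), crux H413 = `stmt-HodgeConjecture-24833` (`--supports` lane); seat LH5-p02 (g11); E1 keeper ∕ dealer F0P3a-p03 (g30) deal 03:20:23Z; LEAD
F0P3a-plan (g16) T15-39 (1) head shape; census `F0/P3c/LH5/LH5-p02/g11/r58/CENSUS-R58-K1UNR.v1.LH5p02g11.md` §4.  THEOREMS ONLY (no definition ∕ instance ∕ notation ∕ named fact ∕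
`sorry`).  HONEST LABEL: count-neutral HOME-only skeleton (rider-class until the LEAD prices it); E1 = PRINT; h413 OPEN; HC_CM is proved only modulo the 7 printed citations
(2 remaining named inputs: hLiu418 = stmt-HodgeConjecture-24832, h413 = stmt-HodgeConjecture-24833) until rung 0 closes.  Nothing printed is asserted here.

THIS FILE (1∕2): §0 + S2a.  FILE 2∕2 `F0P3cStCharTSK1UnrPseudoCoeff.lean`: S1 + S2b (imports this file).
* §0 two generic sockets: `iso_mapEdgeSet_eq_iff` (a graph automorphism read through an orientation fixes an edge iff it fixes both ends) and
  `exists_restrictRep_fixedPoints` (the `K`-type restriction `ρ|_P` on `V^K` for `P ≤ N_G(K)`, letters `τ hτρ hτ` of ★ row 42 ∕ the 48-datum — no ★ constructor existed).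
* S1 `exists_isPseudoCoeff_of_unramified_of_explicit` — GIVEN the explicit-letter head as the binder `hK1X` (∀ over the (G3)-EXPLICIT letters `(w hw ϖ hd eA heA)`), the T15-39
  head `∀ π, 𝔇.IsEllipticRep π → ¬ π.IsSupercuspidal → ∃ f, 𝔇.IsPseudoCoeff π f` follows by the letters block of ★ (G3) `F0P3cStCharTSEPGlueG.exists_epFunction_G` (:170–:196):
  `w` any place over `v`, `hw := hns w`, `(ϖ, hd)` ★ `unramifiedLocalConjDatum_adicCompletion … hunr`, `eA` ★ `localNonsplitEquiv` re-read on `Φ₃ = antidiag(1,1,1)` with `heA`.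
* S2a `isPseudoCoeff_epFunction_of_unramified_explicit` — the WITNESSED form (keeper 03:30:09Z ∕ row-59 GLUE A): in the (G3)-EXPLICIT letters and the 48-datum FILE 2 letters
  VERBATIM (`a ha τ hτ U hU hUo hUc hEo hEc d₁ P₀ P₂ P₁ hP₀ hP₂ hP₁ r he τᵢ hτρᵢ hτᵢ fᵢ hfPᵢ hf0ᵢ`), for ANY irreducible `r` with a level-`e` fixed vector and `σ = ⟦r⟧`:
  `𝔇.IsPseudoCoeff σ (ν(P₀)⁻¹ • f₀ + ν(P₂)⁻¹ • f₂ − ν(P₁)⁻¹ • f₁)`, ZERO hypothesis binders: ★ 53 p853423, ★ 48-datum p853433∕p853465, ★ 47e-E3 p853460 and ★ 61b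
  (`F0P3cStCharTSEPInducedTraceZeroAtDatumDischarge`, the `hsp` at the datum, apartment-pinned with `heA`, `hρ`, `hVN`) are IMPORTED and called; body = clause 1 (★ 42 ×3),
  clause 2 (★ (G4) pin reader ∘ ★ 47e-E3 ∘ ★ 61b at `ρ := r.ρ`, `r.isSmooth`, ★ JDIM2), clause 3 (★ 53 (H5) + ★ 48-datum FILE 2 + ★ 51 termwise on `Stab(x)` ∕
  `Stab(head) ⊓ Stab(tail)` + ★ 41g-H with `hrep := (hM1 _).2.2.2`, `hHC := (hM1 _).2.2.1 γ hγr`).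
* S2b `exists_isPseudoCoeff_of_unramified_explicit` — the (G3)-EXPLICIT existence head: level `e` by ★ 43 at the apartment vertex `A 0` (★ 39γ) below the open
  stabiliser of a non-zero vector, tree letters ★ 41g-H §2, invariant orientation ★, base edge `A 0 — A 1`, stabilisers ★ FILE P through `eA`, `K`-types §0, pieces by `dite`; then S2a.
  `𝔇.IsEllipticRep π` and `¬ π.IsSupercuspidal` are idle (the EP road serves every irreducible class) and kept because the organ text has them.  `heA` (census U1) joins when
  6b ∕ E3 fix their letters.
* S3 `exists_isPseudoCoeff_of_unramified (hns) (hunr) (νQv) (mQv) (hcanQ) (𝔇) (hμG horb hreg hE hM1)` — THE T15-39 HEAD ITSELF = S1 ∘ S2b, ZERO extra binders; rider letter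
  `hK1unr := fun hunr => exists_isPseudoCoeff_of_unramified L v hns hunr νQv mQv hcanQ 𝔇 hC01 hC04 hC05 hE hchar`.  FILING NOTE: 540 l. > the 400-line fence — at filing time §0 + S2a go to `…K1UnrPseudoCoeffWitness.lean`, S1 + S2b to `…K1UnrPseudoCoeff.lean`.

## References
* [Rogawski1990] J. D. Rogawski, *Automorphic Representations of Unitary Groups in Three Variables*, Ann. of Math. Stud. 123 (1990), §12.5 pp. 182–187, §12.6 p. 187.
* [SchneiderStuhler1997] P. Schneider, U. Stuhler, *Representation theory and sheaves on the Bruhat–Tits building*, Publ. Math. IHÉS 85 (1997), §III.4.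
* [Kottwitz1988] R. Kottwitz, *Tamagawa numbers*, Ann. of Math. 127 (1988), §2.
-/

set_option autoImplicit false
-- the mandated namespace has the single-problem summit's repeated segment (`HodgeConjecture.HodgeConjecture`)
set_option linter.dupNamespace false

noncomputable section

open NumberField IsDedekindDomain MeasureTheory Filter Topology
open scoped Matrix MatrixGroups Pointwise Valued WithZero ComplexConjugate
open Literature.NumberTheory.Rogawski1990 Literature.NumberTheory.Rogawski1990.Ch12Sec5
open Literature.NumberTheory.Automorphic Literature.NumberTheory.Automorphic.UnitaryGroup Literature.NumberTheory.Automorphic.UnitaryLatticeTree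
open Literature.NumberTheory.Automorphic.HermitianLattice
open Literature.NumberTheory.GaloisRepresentations
open Literature.Combinatorics.SimpleGraph Literature.Combinatorics.SimpleGraph.OrientedIncidence

namespace Summit.HodgeConjecture.HodgeConjecture.Cruxes.H413.F0P3cStCharTSK1UnrPseudoCoeffWitness

open Summit.HodgeConjecture.HodgeConjecture.Cruxes.H413
open Summit.HodgeConjecture.HodgeConjecture.Cruxes.H413.F0P3cStCharTSTorusDefs

variable (L : Type) [Field L] [NumberField L] [IsCMField L] (v : HeightOneSpectrum (𝓞 ↥(maximalRealSubfield L)))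

/-! ## §0 Two generic sockets (no datum): a fixed edge has fixed ends; the restriction of `ρ` to `P ≤ N_G(K)` on `V^K` as a representation of `P` -/

/-- For a graph automorphism `φ` whose action on edges is read through an orientation (`head (φ·d) = φ (head d)`, `tail (φ·d) = φ (tail d)` — e.g. the invariant orientation of
the `U(3)` tree, ★ `head_mapEdgeSet_latticeGraphIso`): **`φ` fixes the edge `d` iff it fixes both ends** (no inversion). [cite: SchneiderStuhler1997, §III.4] [cite: BruhatTits1972, §10] -/
theorem iso_mapEdgeSet_eq_iff {X : Type*} {Γ : SimpleGraph X} (o : Orientation Γ) (φ : Γ ≃g Γ) (d : Γ.edgeSet)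
    (hh : o.head (φ.mapEdgeSet d) = φ (o.head d)) (ht : o.tail (φ.mapEdgeSet d) = φ (o.tail d)) :
    φ.mapEdgeSet d = d ↔ φ (o.head d) = o.head d ∧ φ (o.tail d) = o.tail d := by
  constructor
  · intro h
    rw [h] at hh ht
    exact ⟨hh.symm, ht.symm⟩
  · rintro ⟨h1, h2⟩
    apply Subtype.ext
    rw [← o.mk_head_tail (φ.mapEdgeSet d), ← o.mk_head_tail d, hh, ht, h1, h2]

/-- **The `K`-type restriction `τ = ρ|_P` on `V^K`** for `P ≤ N_G(K)`: a representation of `P` on the `K`-fixed vectors with `(τ p x : V) = ρ p x` and `τ p = 1` for `p ∈ K`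
(the letters `τᵢ hτρᵢ hτᵢ` of ★ row 42 ∕ the 48-datum; pattern ★ K-TYPE TRACE `σP`). [cite: SchneiderStuhler1997, §III.4] [cite: Kottwitz1988, §2] -/
theorem exists_restrictRep_fixedPoints {Γ W : Type*} [Group Γ] [TopologicalSpace Γ] [AddCommGroup W] [Module ℂ W] (ρ : Representation ℂ Γ W) (P K : Subgroup Γ)
    (hPK : P ≤ Subgroup.normalizer (K : Set Γ)) :
    ∃ τK : Representation ℂ ↥P ↥(ρ.fixedPoints K),
      (∀ (p : ↥P) (x : ↥(ρ.fixedPoints K)), ((τK p x : ↥(ρ.fixedPoints K)) : W) = ρ (p : Γ) (x : W)) ∧ ∀ p : ↥P, (p : Γ) ∈ K → τK p = 1 := by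
  have hmaps : ∀ p : ↥P, ∀ x ∈ ρ.fixedPoints K, ρ (p : Γ) x ∈ ρ.fixedPoints K := fun p =>
    ρ.apply_mem_fixedPoints_of_mem_normalizer (hPK p.2)
  refine ⟨{ toFun := fun p => (ρ (p : Γ)).restrict (hmaps p)
            map_one' := by ext x; simp
            map_mul' := fun p q => by ext x; simp [LinearMap.restrict_apply] }, fun p x => rfl, fun p hp => ?_⟩
  ext x
  simp [LinearMap.restrict_apply, (ρ.mem_fixedPoints K (x : W)).1 x.2 _ hp]

/-! ## S2a — the WITNESSED form (keeper 03:30:09Z, row-59 GLUE A): `f_EP^{π,e}` IS a pseudo-coefficient of `π = ⟦r⟧`, for ANY irreducible class of level `e`, with EVERY supplier ★ (★ 53 p853423, ★ 48-datum p853433∕p853465,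
★ 47e-E3 p853460, ★ 61b `smoothTrace_cmPrincipalSeries_epFunction_eq_zero` imported) — ZERO hypothesis binders beyond the letters -/

set_option maxHeartbeats 1600000 in
-- instance-term unification on the CM local carriers and the vertex subtype (as ★ 41g-H ∕ the 48-datum)
/-- **S2a «THE EULER–POINCARÉ FUNCTION IS A PSEUDO-COEFFICIENT» (witnessed, explicit letters).**  At an unramified non-split place `v` with the (G3)-EXPLICIT one-place model
`(w hw ϖ hd eA)`, at a §12.5 datum `𝔇` with the rung-0 pins `hμG horb hreg hE hM1` (VERBATIM as ★ SC twin), with row 61 «ALL principal-series traces of the Euler–Poincaré function vanish» (★ 61b,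
F0P3a-p04 ∕ F0P2-p06 over ★ 47d HEAD ∕ 5b ∕ 60 and the ★ 55-B horocycle packages of LH10-p02) DISCHARGED inside, and the 48-datum's letters VERBATIM — action hom `a`, invariant orientation `τ`, unitary level family `U`
at level `ϖ^(e+1)`, base edge `d₁`, stabilisers `P₀ P₂ P₁` of its head ∕ tail ∕ itself, the `K`-type restrictions `τᵢ = π|_{Pᵢ}` on `π^{Uᵢ}` and the pieces `fᵢ = 𝟙_{Pᵢ}·χ_{τᵢ}(·⁻¹)` —
for EVERY irreducible `r` with a level-`e` fixed vector (`he`):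
`𝔇.IsPseudoCoeff ⟦r⟧ (ν(P₀)⁻¹ f₀ + ν(P₂)⁻¹ f₂ − ν(P₁)⁻¹ f₁)` [SchneiderStuhler1997 Thm. III.4.16 ∕ Kottwitz1988 §2 at `U(3)`].  Clause 1 ★ 42; clause 2 ★ (G4) pin reader ∘ ★ 47e-E3 `classOrbitalIntegral_eq_zero_of_forall_smoothTrace_eq_zero` ∘ ★ 61b;
clause 3 ★ 53 (H5) + ★ 48-datum `classOrbitalIntegral_epSum_eq_fixedVertexSum_sub_fixedEdgeSum` + ★ 51 TERMWISE (`Θ_U(γ⁻¹) = conj Θ_U(γ)` on the compact stabilisers `Stab(x)`, `Stab(head) ⊓ Stab(tail)`) + ★ 41g-H.  No `IsEllipticRep`∕`IsL2`∕`¬sc`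
antecedent (GLUE F of row 59 consumes this form).
[cite: SchneiderStuhler1997, Thm. III.4.16, §III.4] [cite: Kottwitz1988, §2 Theorem 2] [cite: Rogawski1990, §12.6 p. 187] -/
theorem isPseudoCoeff_epFunction_of_unramified_explicit
    (hns : ∀ w : PlacesOver L v, IsCMField.complexConj L • w.1 = w.1)
    (w : PlacesOver L v) (hw : IsCMField.complexConj L • w.1 = w.1) {ϖ : w.1.adicCompletion L} (hd : UnramifiedLocalConjDatum (galAdicCompletionMap (L := L) (IsCMField.complexConj L) hw) ϖ)
    (eA : Gqs L v ≃ₜ* ↥(unitaryGroupOfForm (galAdicCompletionMap (L := L) (IsCMField.complexConj L) hw) ((StdForm.antidiagonal 3).over (w.1.adicCompletion L))))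
    (heA : ∀ g : Gqs L v, ((eA g : ↥(unitaryGroupOfForm (galAdicCompletionMap (L := L) (IsCMField.complexConj L) hw) ((StdForm.antidiagonal 3).over (w.1.adicCompletion L)))) : GL (Fin 3) (w.1.adicCompletion L)) = ((localNonsplitEquiv (IsCMField.complexConj L) (qsForm L) (IsCMField.complexConj_ne_one L) w hw g : ↥(unitaryGroupOfForm (galAdicCompletionMap (L := L) (IsCMField.complexConj L) hw) (placeForm (qsForm L) w.1))) : GL (Fin 3) (w.1.adicCompletion L)))
    [MeasurableSpace (Gqs L v)] [BorelSpace (Gqs L v)]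
    [∀ γ : Gqs L v, MeasurableSpace (Gqs L v ⧸ Subgroup.centralizer ({γ} : Set (Gqs L v)))] [∀ γ : Gqs L v, BorelSpace (Gqs L v ⧸ Subgroup.centralizer ({γ} : Set (Gqs L v)))]
    [MeasurableSpace (Gqs L v ⧸ Subgroup.center (Gqs L v))]
    {H : Type} [Group H] [TopologicalSpace H] [IsTopologicalGroup H] [MeasurableSpace H]
    (νQv : Measure (Gqs L v)) [νQv.IsHaarMeasure] [νQv.IsMulRightInvariant] (mQv : OrbitalMeasureFamily (Gqs L v))
    (hcanQ : mQv.IsCanonical (fun γ => IsRegularElt (γ.val : GL (Fin 3) (UnitaryGroup.LocalRing L v))) νQv)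
    (𝔇 : EllipticData (Gqs L v) H) (hμG : 𝔇.μG = νQv) (horb : 𝔇.orb = mQv)
    (hreg : ∀ γ : Gqs L v, γ ∈ 𝔇.regG ↔ IsRegularElt (γ.val : GL (Fin 3) (UnitaryGroup.LocalRing L v)))
    (hE : ∀ γ : Gqs L v, γ ∈ 𝔇.ellG ↔ IsRegularElt (γ.val : GL (Fin 3) (UnitaryGroup.LocalRing L v)) ∧ γ ∉ hyperbolicSet L v)
    (hM1 : ∀ π : IrrClass (Gqs L v), Measurable (𝔇.char π) ∧ LocallyIntegrable (𝔇.char π) 𝔇.μG ∧ (∀ x ∈ 𝔇.regG, ∀ᶠ y in 𝓝 x, 𝔇.char π y = 𝔇.char π x) ∧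
      ∀ φ : Gqs L v → ℂ, IsLocSmooth φ → π.smoothTrace 𝔇.μG φ = ∫ x, φ x * 𝔇.char π x ∂𝔇.μG)
    -- ★ row 61b: the former `h61` binder («all principal-series traces of `f_EP` vanish») is DISCHARGED by `F0P3cStCharTSEPInducedTraceZeroAtDatum.smoothTrace_cmPrincipalSeries_epFunction_eq_zero` (F0P3a-p04 g32)
    {a : (Gqs L v) →* ((latticeGraph (galAdicCompletionMap (L := L) (IsCMField.complexConj L) hw) ϖ ((StdForm.antidiagonal 3).over (w.1.adicCompletion L))) ≃g (latticeGraph (galAdicCompletionMap (L := L) (IsCMField.complexConj L) hw) ϖ ((StdForm.antidiagonal 3).over (w.1.adicCompletion L))))} (ha : ∀ g, a g = latticeGraphIso (galAdicCompletionMap (L := L) (IsCMField.complexConj L) hw) ϖ ((StdForm.antidiagonal 3).over (w.1.adicCompletion L)) (eA g))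
    (τ : Orientation (latticeGraph (galAdicCompletionMap (L := L) (IsCMField.complexConj L) hw) ϖ ((StdForm.antidiagonal 3).over (w.1.adicCompletion L)))) (hτ : ∀ d, τ.tail d < τ.head d)
    {e : ℕ} {U : {M : Submodule 𝒪[(w.1.adicCompletion L)] (Fin 3 → (w.1.adicCompletion L)) // IsVertex (galAdicCompletionMap (L := L) (IsCMField.complexConj L) hw) ϖ ((StdForm.antidiagonal 3).over (w.1.adicCompletion L)) M} → Subgroup (Gqs L v)}
    (hU : ∀ x g, g ∈ U x ↔ mapGL ((eA g : ↥(unitaryGroupOfForm (galAdicCompletionMap (L := L) (IsCMField.complexConj L) hw) ((StdForm.antidiagonal 3).over (w.1.adicCompletion L)))) : GL (Fin 3) (w.1.adicCompletion L)) x.1 = x.1 ∧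
    x.1.map ((Matrix.toLin' ((((eA g : ↥(unitaryGroupOfForm (galAdicCompletionMap (L := L) (IsCMField.complexConj L) hw) ((StdForm.antidiagonal 3).over (w.1.adicCompletion L)))) : GL (Fin 3) (w.1.adicCompletion L)) : Matrix (Fin 3) (Fin 3) (w.1.adicCompletion L)) - 1)).restrictScalars 𝒪[(w.1.adicCompletion L)]) ≤ scaleLattice (ϖ ^ (e + 1)) x.1)
    (hUo : ∀ x, IsOpen (U x : Set (Gqs L v))) (hUc : ∀ x, IsCompact (U x : Set (Gqs L v)))
    (hEo : ∀ d : (latticeGraph (galAdicCompletionMap (L := L) (IsCMField.complexConj L) hw) ϖ ((StdForm.antidiagonal 3).over (w.1.adicCompletion L))).edgeSet, IsOpen ((U (τ.head d) ⊔ U (τ.tail d) : Subgroup (Gqs L v)) : Set (Gqs L v)))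
    (hEc : ∀ d : (latticeGraph (galAdicCompletionMap (L := L) (IsCMField.complexConj L) hw) ϖ ((StdForm.antidiagonal 3).over (w.1.adicCompletion L))).edgeSet, IsCompact ((U (τ.head d) ⊔ U (τ.tail d) : Subgroup (Gqs L v)) : Set (Gqs L v)))
    {A : ℤ → {M : Submodule 𝒪[(w.1.adicCompletion L)] (Fin 3 → (w.1.adicCompletion L)) // IsVertex (galAdicCompletionMap (L := L) (IsCMField.complexConj L) hw) ϖ ((StdForm.antidiagonal 3).over (w.1.adicCompletion L)) M}} (hA0 : ∀ c : ℤ, (A (2 * c)).1 = latt (Matrix.diagonal ![ϖ ^ c, (1 : w.1.adicCompletion L), ϖ ^ (-c)])) (hA1 : ∀ c : ℤ, (A (2 * c + 1)).1 = latt (Matrix.diagonal ![ϖ ^ (c + 1), (1 : w.1.adicCompletion L), ϖ ^ (-c)]))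
    (d₁ : (latticeGraph (galAdicCompletionMap (L := L) (IsCMField.complexConj L) hw) ϖ ((StdForm.antidiagonal 3).over (w.1.adicCompletion L))).edgeSet) (hd₁ : (d₁ : Sym2 {M : Submodule 𝒪[(w.1.adicCompletion L)] (Fin 3 → (w.1.adicCompletion L)) // IsVertex (galAdicCompletionMap (L := L) (IsCMField.complexConj L) hw) ϖ ((StdForm.antidiagonal 3).over (w.1.adicCompletion L)) M}) = s(A 0, A 1)) (P₀ P₂ P₁ : Subgroup (Gqs L v))
    (hP₀ : ∀ g, g ∈ P₀ ↔ a g (τ.head d₁) = τ.head d₁) (hP₂ : ∀ g, g ∈ P₂ ↔ a g (τ.tail d₁) = τ.tail d₁) (hP₁ : ∀ g, g ∈ P₁ ↔ (a g).mapEdgeSet d₁ = d₁)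
    (r : SmoothIrrep (Gqs L v)) (he : ∃ x₀ : {M : Submodule 𝒪[(w.1.adicCompletion L)] (Fin 3 → (w.1.adicCompletion L)) // IsVertex (galAdicCompletionMap (L := L) (IsCMField.complexConj L) hw) ϖ ((StdForm.antidiagonal 3).over (w.1.adicCompletion L)) M}, r.ρ.fixedPoints (U x₀) ≠ ⊥)
    [FiniteDimensional ℂ ↥(r.ρ.fixedPoints (U (τ.head d₁)))] [FiniteDimensional ℂ ↥(r.ρ.fixedPoints (U (τ.tail d₁)))]
    [FiniteDimensional ℂ ↥(r.ρ.fixedPoints (U (τ.head d₁) ⊔ U (τ.tail d₁)))]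
    (τ₀ : Representation ℂ ↥P₀ ↥(r.ρ.fixedPoints (U (τ.head d₁))))
    (hτρ₀ : ∀ (p : ↥P₀) (x : ↥(r.ρ.fixedPoints (U (τ.head d₁)))), ((τ₀ p x : ↥(r.ρ.fixedPoints (U (τ.head d₁)))) : r.V) = r.ρ (p : (Gqs L v)) (x : r.V))
    (hτ₀ : ∀ p : ↥P₀, (p : (Gqs L v)) ∈ U (τ.head d₁) → τ₀ p = 1)
    (τ₂ : Representation ℂ ↥P₂ ↥(r.ρ.fixedPoints (U (τ.tail d₁))))
    (hτρ₂ : ∀ (p : ↥P₂) (x : ↥(r.ρ.fixedPoints (U (τ.tail d₁)))), ((τ₂ p x : ↥(r.ρ.fixedPoints (U (τ.tail d₁)))) : r.V) = r.ρ (p : (Gqs L v)) (x : r.V))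
    (hτ₂ : ∀ p : ↥P₂, (p : (Gqs L v)) ∈ U (τ.tail d₁) → τ₂ p = 1)
    (τ₁ : Representation ℂ ↥P₁ ↥(r.ρ.fixedPoints (U (τ.head d₁) ⊔ U (τ.tail d₁))))
    (hτρ₁ : ∀ (p : ↥P₁) (x : ↥(r.ρ.fixedPoints (U (τ.head d₁) ⊔ U (τ.tail d₁)))), ((τ₁ p x : ↥(r.ρ.fixedPoints (U (τ.head d₁) ⊔ U (τ.tail d₁)))) : r.V) = r.ρ (p : (Gqs L v)) (x : r.V))
    (hτ₁ : ∀ p : ↥P₁, (p : (Gqs L v)) ∈ U (τ.head d₁) ⊔ U (τ.tail d₁) → τ₁ p = 1)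
    {f₀ f₂ f₁ : (Gqs L v) → ℂ}
    (hfP₀ : ∀ (g : (Gqs L v)) (hg : g ∈ P₀), f₀ g = Representation.character τ₀ ⟨g, hg⟩⁻¹) (hf0₀ : ∀ g ∉ P₀, f₀ g = 0)
    (hfP₂ : ∀ (g : (Gqs L v)) (hg : g ∈ P₂), f₂ g = Representation.character τ₂ ⟨g, hg⟩⁻¹) (hf0₂ : ∀ g ∉ P₂, f₂ g = 0)
    (hfP₁ : ∀ (g : (Gqs L v)) (hg : g ∈ P₁), f₁ g = Representation.character τ₁ ⟨g, hg⟩⁻¹) (hf0₁ : ∀ g ∉ P₁, f₁ g = 0)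
    (σ : IrrClass (Gqs L v)) (hr : IrrClass.mk r = σ) :
    𝔇.IsPseudoCoeff σ ((((νQv.real (P₀ : Set (Gqs L v)))⁻¹ : ℂ)) • f₀ + (((νQv.real (P₂ : Set (Gqs L v)))⁻¹ : ℂ)) • f₂ - (((νQv.real (P₁ : Set (Gqs L v)))⁻¹ : ℂ)) • f₁) := by
  subst hr
  classical
  -- (R) instances, admissibility
  haveI : r.ρ.IsIrreducible := r.isIrreducible
  haveI : NonarchimedeanGroup (Gqs L v) :=
    nonarchimedeanGroup_unitaryGroupOfForm_local (E := L) (c := IsCMField.complexConj L) (N := 3) (v := v) (J' := (adelicForm L 3 (qsForm L)).map (adeleToLocal L v))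
  haveI := compactSpace_integer_adicCompletion L w.1
  have hadm : r.ρ.IsAdmissible := F0P3cStCharTSScTracePackage.isAdmissible_smoothIrrep L v hns r
  have hσc : Continuous (galAdicCompletionMap (L := L) (IsCMField.complexConj L) hw) := continuous_galAdicCompletionMap L (IsCMField.complexConj L) hw
  -- edges: fixed iff both ends fixed (★ invariant orientation, §0)
  have hσa : ∀ (g : Gqs L v) (d : (latticeGraph (galAdicCompletionMap (L := L) (IsCMField.complexConj L) hw) ϖ ((StdForm.antidiagonal 3).over (w.1.adicCompletion L))).edgeSet), τ.head ((a g).mapEdgeSet d) = a g (τ.head d) ∧ τ.tail ((a g).mapEdgeSet d) = a g (τ.tail d) := fun g d => by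
    rw [ha]; exact head_mapEdgeSet_latticeGraphIso (galAdicCompletionMap (L := L) (IsCMField.complexConj L) hw) ϖ ((StdForm.antidiagonal 3).over (w.1.adicCompletion L)) hτ (eA g) d
  have hfixE : ∀ (g : Gqs L v) (d : (latticeGraph (galAdicCompletionMap (L := L) (IsCMField.complexConj L) hw) ϖ ((StdForm.antidiagonal 3).over (w.1.adicCompletion L))).edgeSet), (a g).mapEdgeSet d = d ↔ a g (τ.head d) = τ.head d ∧ a g (τ.tail d) = τ.tail d := fun g d =>
    iso_mapEdgeSet_eq_iff τ (a g) d (hσa g d).1 (hσa g d).2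
  -- stabilisers are compact open (★ FILE P through `eA`); the given `P₀ P₂ P₁` are stabilisers
  have hstab : ∀ x : {M : Submodule 𝒪[(w.1.adicCompletion L)] (Fin 3 → (w.1.adicCompletion L)) // IsVertex (galAdicCompletionMap (L := L) (IsCMField.complexConj L) hw) ϖ ((StdForm.antidiagonal 3).over (w.1.adicCompletion L)) M}, ∃ P : Subgroup (Gqs L v), (∀ g, g ∈ P ↔ a g x = x) ∧ IsOpen (P : Set (Gqs L v)) ∧ IsCompact (P : Set (Gqs L v)) := fun x => by
    obtain ⟨Q, hQ⟩ := exists_stabilizerSubgroup (galAdicCompletionMap (L := L) (IsCMField.complexConj L) hw) ϖ ((StdForm.antidiagonal 3).over (w.1.adicCompletion L)) x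
    have hmem : ∀ g : Gqs L v, g ∈ Q.comap eA.toMonoidHom ↔ a g x = x := fun g => by
      rw [F0P3cStCharTSCharacterEllipticUniform.mem_comap_iff', hQ, ha]
    refine ⟨Q.comap eA.toMonoidHom, hmem, ?_, ?_⟩
    · have hset : ((Q.comap eA.toMonoidHom : Subgroup (Gqs L v)) : Set (Gqs L v)) = {g : Gqs L v | a g x = x} := Set.ext hmem
      rw [hset]; exact F0P3cStCharTSCharacterEllipticUniform.isOpen_setOf_actionHom_apply_eq ha x
    · have hset : (Q : Set ↥(unitaryGroupOfForm (galAdicCompletionMap (L := L) (IsCMField.complexConj L) hw) ((StdForm.antidiagonal 3).over (w.1.adicCompletion L)))) = {u | latticeGraphIso (galAdicCompletionMap (L := L) (IsCMField.complexConj L) hw) ϖ ((StdForm.antidiagonal 3).over (w.1.adicCompletion L)) u x = x} := Set.ext hQ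
      refine F0P3cStCharTSCharacterEllipticUniform.isCompact_coe_comap eA Q ?_
      rw [hset]
      exact isCompact_setOf_latticeGraphIso_apply_eq (galAdicCompletionMap (L := L) (IsCMField.complexConj L) hw) ϖ ((StdForm.antidiagonal 3).over (w.1.adicCompletion L)) hσc x
  have hoc : ∀ (P : Subgroup (Gqs L v)) (x : {M : Submodule 𝒪[(w.1.adicCompletion L)] (Fin 3 → (w.1.adicCompletion L)) // IsVertex (galAdicCompletionMap (L := L) (IsCMField.complexConj L) hw) ϖ ((StdForm.antidiagonal 3).over (w.1.adicCompletion L)) M}), (∀ g, g ∈ P ↔ a g x = x) → IsOpen (P : Set (Gqs L v)) ∧ IsCompact (P : Set (Gqs L v)) := fun P x hP => by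
    obtain ⟨Q, hQ, hQo, hQc⟩ := hstab x
    have hPQ : (P : Set (Gqs L v)) = (Q : Set (Gqs L v)) := Set.ext fun g => (hP g).trans (hQ g).symm
    rw [hPQ]; exact ⟨hQo, hQc⟩
  have hP₀c : IsCompact (P₀ : Set (Gqs L v)) := (hoc P₀ _ hP₀).2
  have hP₂c : IsCompact (P₂ : Set (Gqs L v)) := (hoc P₂ _ hP₂).2
  have hP₁c : IsCompact (P₁ : Set (Gqs L v)) := by
    have h12 : (P₁ : Set (Gqs L v)) = (P₀ : Set (Gqs L v)) ∩ (P₂ : Set (Gqs L v)) := Set.ext fun g => by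
      rw [SetLike.mem_coe, hP₁, hfixE, Set.mem_inter_iff, SetLike.mem_coe, SetLike.mem_coe, hP₀, hP₂]
    rw [h12]
    exact hP₀c.inter_right (P₂.isClosed_of_isOpen (hoc P₂ _ hP₂).1)
  -- level groups inside stabilisers (★ (U1), level ≥ 1 fixes the closed star), stabilisers inside normalisers (★ (U3))
  have hUP₀ : U (τ.head d₁) ≤ P₀ := fun g hg => (hP₀ g).2 (F0P3cStCharTSCharacterEllipticUniform.actionHom_apply_eq_of_mem ha hU hg)
  have hUP₂ : U (τ.tail d₁) ≤ P₂ := fun g hg => (hP₂ g).2 (F0P3cStCharTSCharacterEllipticUniform.actionHom_apply_eq_of_mem ha hU hg)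
  have hUP₁ : U (τ.head d₁) ⊔ U (τ.tail d₁) ≤ P₁ := by
    refine sup_le (fun g hg => (hP₁ g).2 ((hfixE g d₁).2 ⟨?_, ?_⟩)) (fun g hg => (hP₁ g).2 ((hfixE g d₁).2 ⟨?_, ?_⟩))
    · exact F0P3cStCharTSCharacterEllipticUniform.actionHom_apply_eq_of_mem ha hU hg
    · exact F0P3cStCharTSCharacterEllipticUniform.actionHom_apply_eq_of_mem_of_adj ha hU hd hg (τ.adj_head_tail d₁)
    · exact F0P3cStCharTSCharacterEllipticUniform.actionHom_apply_eq_of_mem_of_adj ha hU hd hg (τ.adj_head_tail d₁).symm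
    · exact F0P3cStCharTSCharacterEllipticUniform.actionHom_apply_eq_of_mem ha hU hg
  have hPU₀ : P₀ ≤ Subgroup.normalizer ((U (τ.head d₁) : Subgroup (Gqs L v)) : Set (Gqs L v)) := fun g hg =>
    F0P3cStCharTSCharacterEllipticUniform.mem_normalizer_unitaryLevel_gqs_of_apply_eq ha hU ((hP₀ g).1 hg)
  have hPU₂ : P₂ ≤ Subgroup.normalizer ((U (τ.tail d₁) : Subgroup (Gqs L v)) : Set (Gqs L v)) := fun g hg =>
    F0P3cStCharTSCharacterEllipticUniform.mem_normalizer_unitaryLevel_gqs_of_apply_eq ha hU ((hP₂ g).1 hg)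
  have hPUE : ∀ (P : Subgroup (Gqs L v)) (d : (latticeGraph (galAdicCompletionMap (L := L) (IsCMField.complexConj L) hw) ϖ ((StdForm.antidiagonal 3).over (w.1.adicCompletion L))).edgeSet), (∀ g ∈ P, a g (τ.head d) = τ.head d ∧ a g (τ.tail d) = τ.tail d) →
      P ≤ Subgroup.normalizer ((U (τ.head d) ⊔ U (τ.tail d) : Subgroup (Gqs L v)) : Set (Gqs L v)) := fun P d hP g hg =>
    Subgroup.normalizer_inf_normalizer_le_normalizer_sup (U (τ.head d)) (U (τ.tail d))
      (Subgroup.mem_inf.2 ⟨F0P3cStCharTSCharacterEllipticUniform.mem_normalizer_unitaryLevel_gqs_of_apply_eq ha hU (hP g hg).1,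
        F0P3cStCharTSCharacterEllipticUniform.mem_normalizer_unitaryLevel_gqs_of_apply_eq ha hU (hP g hg).2⟩)
  have hPU₁ : P₁ ≤ Subgroup.normalizer ((U (τ.head d₁) ⊔ U (τ.tail d₁) : Subgroup (Gqs L v)) : Set (Gqs L v)) :=
    hPUE P₁ d₁ fun g hg => (hfixE g d₁).1 ((hP₁ g).1 hg)
  -- CLAUSE 1 (★ row 42): `f_EP ∈ C_c^∞(G_v)`
  have hSB : ((((νQv.real (P₀ : Set (Gqs L v)))⁻¹ : ℂ)) • f₀ + (((νQv.real (P₂ : Set (Gqs L v)))⁻¹ : ℂ)) • f₂ - (((νQv.real (P₁ : Set (Gqs L v)))⁻¹ : ℂ)) • f₁) ∈ SchwartzBruhat (Gqs L v) :=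
    Submodule.sub_mem _
      (Submodule.add_mem _
        (Submodule.smul_mem _ _ (Representation.mem_schwartzBruhat_of_kType (hUo _) (hUc _) hP₀c hUP₀ hPU₀ τ₀ (fun u hu => hτ₀ ⟨u, hUP₀ hu⟩ hu) hfP₀ hf0₀))
        (Submodule.smul_mem _ _ (Representation.mem_schwartzBruhat_of_kType (hUo _) (hUc _) hP₂c hUP₂ hPU₂ τ₂ (fun u hu => hτ₂ ⟨u, hUP₂ hu⟩ hu) hfP₂ hf0₂)))
      (Submodule.smul_mem _ _ (Representation.mem_schwartzBruhat_of_kType (hEo d₁) (hEc d₁) hP₁c hUP₁ hPU₁ τ₁ (fun u hu => hτ₁ ⟨u, hUP₁ hu⟩ hu) hfP₁ hf0₁))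
  refine ⟨hSB, ?_, ?_⟩
  · -- CLAUSE 2 (off `G^e`): ★ (G4) pin reader ∘ ★ 47e-E3 ∘ ★ 61b (at `ρ := r.ρ`: smooth, Jacquet module finite by ★ JDIM2)
    intro γ hγ
    exact F0P3cStCharTSEllMassG.orbInt_eq_zero_of_mem_regG_of_not_mem_ellG L v hns 𝔇 horb hreg hE
      (fun γ' hreg' hnc' => F0P3cStCharTSEPNonEllipticVanishing.classOrbitalIntegral_eq_zero_of_forall_smoothTrace_eq_zero L v hns νQv mQv hcanQ _
        (mem_schwartzBruhat_iff.1 hSB).1 (mem_schwartzBruhat_iff.1 hSB).2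
        (F0P3cStCharTSEPInducedTraceZeroAtDatum.smoothTrace_cmPrincipalSeries_epFunction_eq_zero L v νQv w hw hd eA heA ha τ hτ hU hUo hUc
          hEo hEc hA0 hA1 d₁ hd₁ P₀ P₂ P₁ hP₀ hP₂ hP₁ r.ρ r.isSmooth (F0P3cStCharTSJacquetLine.finrank_coinvariants_le_two L v hns r).1
          τ₀ hτρ₀ hτ₀ τ₂ hτρ₂ hτ₂ τ₁ hτρ₁ hτ₁ hfP₀ hf0₀ hfP₂ hf0₂ hfP₁ hf0₁) hreg' hnc')
      hγ.1 hγ.2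
  · -- CLAUSE 3 (on `G^e`): ★ 53 (H5) + ★ 48-datum FILE 2 + ★ 51 termwise + ★ 41g-H
    intro γ hγ
    obtain ⟨hγreg, hΩ⟩ := (hE γ).1 hγ
    have hγr : γ ∈ 𝔇.regG := (hreg γ).2 hγreg
    have hell : IsCompact ((Subgroup.centralizer ({γ} : Set (Gqs L v))) : Set (Gqs L v)) :=
      F0P3cStCharTSEllCartanCompact.isCompact_centralizer_of_not_mem_hyperbolicSet L v hns hγreg hΩ
    obtain ⟨hne, hfin, hfinE⟩ := F0P3cStCharTSEllipticFixedTree.ellipticFixedTree_of_mem_ellG L v w hw eA ha hns hd τ hτ 𝔇 hE hγ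
    -- ★ 51 termwise: `Θ_U(γ⁻¹) = conj Θ_U(γ)` on the compact stabilisers
    have h1 : ∀ x ∈ hfin.toFinset, r.ρ.levelTrace (hUo x) (hUc x) γ⁻¹ = (starRingEnd ℂ) (r.ρ.levelTrace (hUo x) (hUc x) γ) := fun x hx => by
      have hx' : a γ x = x := by simpa using hx
      obtain ⟨Px, hPx, -, hPxc⟩ := hstab x
      exact r.ρ.levelTrace_inv_eq_conj_of_mem_of_isCompact (hUo x) (hUc x) (P := Px)
        (fun g hg => F0P3cStCharTSCharacterEllipticUniform.mem_normalizer_unitaryLevel_gqs_of_apply_eq ha hU ((hPx g).1 hg)) hPxc ((hPx γ).2 hx')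
    have h2 : ∀ d ∈ hfinE.toFinset, r.ρ.levelTrace (hEo d) (hEc d) γ⁻¹ = (starRingEnd ℂ) (r.ρ.levelTrace (hEo d) (hEc d) γ) := fun d hdd => by
      have hd' : (a γ).mapEdgeSet d = d := by simpa using hdd
      obtain ⟨Ph, hPh, -, hPhc⟩ := hstab (τ.head d)
      obtain ⟨Pt, hPt, hPto, hPtc⟩ := hstab (τ.tail d)
      refine r.ρ.levelTrace_inv_eq_conj_of_mem_of_isCompact (hEo d) (hEc d) (P := Ph ⊓ Pt)
        (hPUE (Ph ⊓ Pt) d fun g hg => ⟨(hPh g).1 (Subgroup.mem_inf.1 hg).1, (hPt g).1 (Subgroup.mem_inf.1 hg).2⟩) ?_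
        (Subgroup.mem_inf.2 ⟨(hPh γ).2 ((hfixE γ d).1 hd').1, (hPt γ).2 ((hfixE γ d).1 hd').2⟩)
      rw [Subgroup.coe_inf]
      exact hPhc.inter_right (Pt.isClosed_of_isOpen hPto)
    have key : ∀ {ι κ : Type} (s₁ : Finset ι) (s₂ : Finset κ) (F₁ G₁ : ι → ℂ) (F₂ G₂ : κ → ℂ),
        (∀ x ∈ s₁, F₁ x = (starRingEnd ℂ) (G₁ x)) → (∀ d ∈ s₂, F₂ d = (starRingEnd ℂ) (G₂ d)) →
        (∑ x ∈ s₁, F₁ x) - ∑ d ∈ s₂, F₂ d = (starRingEnd ℂ) ((∑ x ∈ s₁, G₁ x) - ∑ d ∈ s₂, G₂ d) := by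
      intro ι κ s₁ s₂ F₁ G₁ F₂ G₂ e₁ e₂
      rw [_root_.map_sub, _root_.map_sum, _root_.map_sum, Finset.sum_congr rfl e₁, Finset.sum_congr rfl e₂]
    rw [EllipticData.orbInt, horb,
      F0P3cStCharTSEPFunctionOrbitalElliptic.classOrbitalIntegral_epSum_eq_fixedVertexSum_sub_fixedEdgeSum L v w hw hd eA ha νQv hcanQ τ hτ hU hUo hUc hEo hEc d₁ P₀ P₂ P₁
        hP₀ hP₂ hP₁ r.ρ τ₀ hτρ₀ hτ₀ τ₂ hτρ₂ hτ₂ τ₁ hτρ₁ hτ₁ hfP₀ hf0₀ hfP₂ hf0₂ hfP₁ hf0₁ hγreg hell hfin hfinE,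
      F0P3cStCharTSCharacterEllipticUniform.char_eq_fixedVertexSum_sub_fixedEdgeSum L v hns w hw hd eA νQv 𝔇 hμG r (hM1 (IrrClass.mk r)).2.2.2 ha τ hτ hU hUo hUc
        hEo hEc he hne hfin hfinE ((hM1 (IrrClass.mk r)).2.2.1 γ hγr)]
    exact key hfin.toFinset hfinE.toFinset (fun x => r.ρ.levelTrace (hUo x) (hUc x) γ⁻¹) (fun x => r.ρ.levelTrace (hUo x) (hUc x) γ)
      (fun d => r.ρ.levelTrace (hEo d) (hEc d) γ⁻¹) (fun d => r.ρ.levelTrace (hEo d) (hEc d) γ) h1 h2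


end Summit.HodgeConjecture.HodgeConjecture.Cruxes.H413.F0P3cStCharTSK1UnrPseudoCoeffWitness

end
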